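import Mathlib
import Literature.MathematicalPhysics.QuantumFieldTheory.Luscher2010.TrivializingMaps
import Literature.MathematicalPhysics.QuantumFieldTheory.Luscher2010.FlowActionSeries
import Summits.Ventures.LatticeQCDFlow.TrivializingMaps.Truncation
import Summits.Ventures.LatticeQCDFlow.TrivializingMaps.TruncationDefect
import Summits.Ventures.LatticeQCDFlow.TrivializingMaps.SeriesUniqueness
import Summits.Ventures.LatticeQCDFlow.TrivializingMaps.LinkPolynomials
import Summits.Ventures.LatticeQCDFlow.TrivializingMaps.WilsonPolynomials
import Summits.Ventures.LatticeQCDFlow.TrivializingMaps.LuscherSeriesExistence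
import Summits.Ventures.LatticeQCDFlow.TrivializingMaps.ExtensiveDefectReduction
import Summits.Ventures.LatticeQCDFlow.TrivializingMaps.ExtensiveDefect
import HarnessLib

/-!
# Volume-independent gradient bounds for the Lüscher series of the Wilson action, order by order

HONEST FRAMING: exact (Metropolis-corrected) sampling algorithms for lattice gauge theory; figures of merit are
autocorrelation/cost numbers at stated couplings and volumes; no continuum-physics claim.

Venture `LatticeQCDFlow` (cell pub-lqcd), topic `TrivializingMaps`, FANOUT row 28 (theory-1).  Lüscher, CMP 293
(2010) 899 [Luscher2010Trivializing, arXiv:0907.5491], §4.5(b): the flow-action series "is an expansion in local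
terms" whose "coefficients are volume-independent".  The footprint half is `LuscherFootprintLinear`
(`LuscherSeriesExistence.lean`); this file proves the COEFFICIENT half, order by order, as a theorem about link
gradients — the quantity the sampler actually uses (the generator is `Z_t = -∂S̃_t`):

* `seriesGradientBound (d n k)`: there is `C_k = C_k(d, n) ≥ 0` such that for EVERY lattice size `L`, every
  orthonormal basis `B` of `𝔰𝔲(n)`, every smooth solution `(S̃^{(j)}, Ċ^{(j)})` of Lüscher's recursion
  (4.12)–(4.13) for the Wilson action, every `U ∈ SU(n)^E`, link `e` and colour index `a`:
  `|∂^a_e S̃^{(k)}(ιU)| ≤ C_k`;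
* `seriesGradientBound_smul`: for the action `β S_W` the same holds with `|β|^{k+1} C_k`;
* `luscherUniformGradientBound (d n)`: the `∃ C : ℕ → ℝ` form — literally `LuscherGeometricGradientBound d n`
  (`Truncation.lean` §6, conjecture: `C ρ^{-k}`) with the geometric rate replaced by an arbitrary sequence.  It is
  the unconditional statement slot into which a proof of the rate would later be substituted; NO claim on the
  size or growth of the `C_k` is made (they are compactness constants, `anchTermGradBound`).

Ingredients (all ours, elementary): the ball `linkBall R e` of the plaquette-adjacency graph is SYMMETRIC
(`mem_linkBall_comm`, so at most `(1+16d²)^R` anchors `e₀` have `e` in their ball), the anchored decomposition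
`S̃^{(k)} = ∑_{e₀} G^{(k)}_{e₀}` with `G^{(k)}_{e₀}` depending only on `linkBall (k+1) e₀` and the volume-uniform
bound `anchTermGradBound` (`ExtensiveDefect.lean`), and uniqueness of gradients of smooth Lüscher series
(`IsLuscherSeries.linkDeriv_eq`, `SeriesUniqueness.lean`), which transfers the bound from the constructed series
`wilsonSk` to every solution.

References: M. Lüscher, Commun. Math. Phys. 293 (2010) 899–919 [Luscher2010Trivializing], §4.3 eqs. (4.12)–(4.15),
§4.5(a)(b).  Printed counterparts named only.
-/

namespace Summit.Ventures.LatticeQCDFlow.TrivializingMaps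

open Literature.MathematicalPhysics.QuantumFieldTheory
open Literature.MathematicalPhysics.QuantumFieldTheory.Luscher2010
open scoped Matrix Matrix.Norms.Frobenius ContDiff

noncomputable section

variable {d L n : ℕ}

/-! ## §1. The plaquette-adjacency ball is symmetric -/

section Symmetry

/-- Sharing a plaquette is a symmetric relation. [folklore] -/
theorem plaqNbhd_comm {e e' : Edge d L} : e' ∈ plaqNbhd e ↔ e ∈ plaqNbhd e' := by
  simp only [plaqNbhd, Set.mem_setOf_eq]
  exact ⟨fun ⟨x, μ, ν, hμν, h1, h2⟩ => ⟨x, μ, ν, hμν, h2, h1⟩,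
    fun ⟨x, μ, ν, hμν, h1, h2⟩ => ⟨x, μ, ν, hμν, h2, h1⟩⟩

/-- Radius zero: the ball is the link itself. [folklore] -/
theorem mem_linkBall_zero (e e'' : Edge d L) : e'' ∈ linkBall 0 e ↔ e'' = e := by
  simp only [linkBall, Set.mem_singleton_iff]

/-- One step of the ball, by the LAST step (the defining clause). [folklore] -/
theorem mem_linkBall_succ (R : ℕ) (e e'' : Edge d L) :
    e'' ∈ linkBall (R + 1) e ↔ ∃ e' ∈ linkBall R e, e'' = e' ∨ e'' ∈ plaqNbhd e' := by
  simp only [linkBall, Set.mem_setOf_eq]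

/-- One step of the ball, by the FIRST step. [folklore] -/
theorem mem_linkBall_succ_iff_first (R : ℕ) : ∀ e e'' : Edge d L,
    e'' ∈ linkBall (R + 1) e ↔ ∃ e', (e' = e ∨ e' ∈ plaqNbhd e) ∧ e'' ∈ linkBall R e' := by
  induction R with
  | zero =>
    intro e e''
    rw [mem_linkBall_succ 0 e e'']
    simp only [mem_linkBall_zero, exists_eq_left, exists_eq_right']
  | succ R ih =>
    intro e e''
    rw [mem_linkBall_succ (R + 1) e e'']
    constructor
    · rintro ⟨e₁, he₁, hP⟩
      obtain ⟨e', hQ, he₁'⟩ := (ih e e₁).1 he₁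
      exact ⟨e', hQ, (mem_linkBall_succ R e' e'').2 ⟨e₁, he₁', hP⟩⟩
    · rintro ⟨e', hQ, h⟩
      obtain ⟨e₁, he₁', hP⟩ := (mem_linkBall_succ R e' e'').1 h
      exact ⟨e₁, (ih e e₁).2 ⟨e', hQ, he₁'⟩, hP⟩

/-- **The ball of the plaquette-adjacency graph is symmetric**: `e'' ∈ linkBall R e ↔ e ∈ linkBall R e''`.
[folklore] -/
theorem mem_linkBall_comm : ∀ (R : ℕ) (e e'' : Edge d L), e'' ∈ linkBall R e ↔ e ∈ linkBall R e'' := by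
  intro R
  induction R with
  | zero =>
    intro e e''
    rw [mem_linkBall_zero e e'', mem_linkBall_zero e'' e]
    exact eq_comm
  | succ R ih =>
    intro e e''
    rw [mem_linkBall_succ R e e'', mem_linkBall_succ_iff_first R e'' e]
    constructor
    · rintro ⟨e', he', hP⟩
      refine ⟨e', ?_, (ih e e').1 he'⟩
      rcases hP with h | h
      · exact Or.inl h.symm
      · exact Or.inr (plaqNbhd_comm.1 h)
    · rintro ⟨e', hQ, he⟩
      refine ⟨e', (ih e e').2 he, ?_⟩
      rcases hQ with h | h
      · exact Or.inl h.symm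
      · exact Or.inr (plaqNbhd_comm.2 h)

end Symmetry

/-! ## §2. Sums over anchors whose ball contains a given link -/

section Counting

variable [NeZero L]

/-- **At most `(1+16d²)^R` anchors see a given link.** A sum over anchors `e₀` supported on
`{e₀ | e ∈ linkBall R e₀}` with terms bounded by `K ≥ 0` is at most `(1+16d²)^R · K` in absolute value
(`abs_sum_linkBall_le` through the symmetry of the ball). [folklore] -/
theorem abs_sum_anchor_le (R : ℕ) (e : Edge d L) (g : Edge d L → ℝ) {K : ℝ} (hK0 : 0 ≤ K)
    (h0 : ∀ e₀, e ∉ linkBall R e₀ → g e₀ = 0) (hK : ∀ e₀, |g e₀| ≤ K) :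
    |∑ e₀, g e₀| ≤ (1 + 16 * (d * d)) ^ R * K :=
  abs_sum_linkBall_le R e g hK0 (fun e₀ he₀ => h0 e₀ fun h => he₀ ((mem_linkBall_comm R e₀ e).1 h)) hK

end Counting

/-! ## §3. Volume-uniform gradient bounds, order by order -/

section Main

/-- **Gradient bound for the constructed series.** For every order `k` there is `C ≥ 0` with
`|∂_{e,Y} S̃_W^{(k)}(ιU)| ≤ C` for all `L`, all bases `B`, all links `e`, all unit `Y ∈ 𝔰𝔲(n)`, all `U ∈ SU(n)^E`
(`S̃_W^{(k)} = wilsonSk`: only the `≤ (1+16d²)^{k+1}` anchored terms whose ball contains `e` contribute, each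
bounded by `anchTermGradBound`). [cite: Luscher2010Trivializing, §4.5(b)] -/
theorem wilsonSk_gradBound (d n k : ℕ) : ∃ C : ℝ, 0 ≤ C ∧ ∀ (L : ℕ) [NeZero L] (B : SuBasis n)
    (e : Edge d L) (Y : Matrix (Fin n) (Fin n) ℂ), Y ∈ suAlgebra n → ‖Y‖ ≤ 1 →
      ∀ U : GaugeConfig d L (Matrix.specialUnitaryGroup (Fin n) ℂ),
        |linkDeriv e Y (wilsonSk d L B k) (WilsonFlow.coeConfig U)| ≤ C := by
  obtain ⟨c, hc0, hc⟩ := anchTermGradBound d n k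
  refine ⟨(1 + 16 * (d * d)) ^ (k + 1) * c, by positivity, fun L _ B e Y hY hY1 U => ?_⟩
  have hD : linkDeriv e Y (wilsonSk d L B k) (WilsonFlow.coeConfig U) =
      ∑ e₀ : Edge d L, linkDeriv e Y (anchTerm B k e₀) (WilsonFlow.coeConfig U) := by
    have h := linkDeriv_finset_sum e Y Finset.univ (fun e₀ : Edge d L => anchTerm B k e₀)
      (fun e₀ _ => contDiff_anchTerm B k e₀)
    rw [show wilsonSk d L B k = fun W => ∑ e₀ : Edge d L, anchTerm B k e₀ W from rfl]
    exact congrFun h (WilsonFlow.coeConfig U)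
  rw [hD]
  refine abs_sum_anchor_le (k + 1) e _ hc0 (fun e₀ he₀ => ?_) (fun e₀ => hc L B e₀ e Y hY hY1 U)
  rw [linkDeriv_eq_zero_of_not_mem Y (Submodule.mem_inf.1 (anchTerm_mem B k e₀)).2 he₀]

/-- **Volume-independent coefficients, order by order** (Lüscher §4.5(b), gradient form): for every order `k`
there is `C_k = C_k(d,n) ≥ 0` such that for every lattice size `L`, basis `B`, every SMOOTH solution of Lüscher's
recursion for the Wilson action, every `U ∈ SU(n)^E`, link `e` and colour `a`: `|∂^a_e S̃^{(k)}(ιU)| ≤ C_k`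
(all smooth solutions have the gradients of the constructed one, `IsLuscherSeries.linkDeriv_eq`).
[cite: Luscher2010Trivializing, §4.5(b)] -/
theorem seriesGradientBound (d n k : ℕ) : ∃ C : ℝ, 0 ≤ C ∧ ∀ (L : ℕ) [NeZero L] (B : SuBasis n)
    (Sk : ℕ → AmbConfig d L n → ℝ) (c : ℕ → ℝ), (∀ j, ContDiff ℝ ∞ (Sk j)) →
      IsLuscherSeries B ambWilsonAction Sk c →
      ∀ (U : GaugeConfig d L (Matrix.specialUnitaryGroup (Fin n) ℂ)) (e : Edge d L) (a : B.ι),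
        |linkDeriv e (B.T a) (Sk k) (WilsonFlow.coeConfig U)| ≤ C := by
  obtain ⟨C, hC0, hC⟩ := wilsonSk_gradBound d n k
  refine ⟨C, hC0, fun L _ B Sk c hsm hser U e a => ?_⟩
  rw [(IsLuscherSeries.linkDeriv_eq hser (isLuscherSeries_wilsonSk B) hsm
    (fun j => contDiff_wilsonSk B j) k).2 e a U]
  exact hC L B e (B.T a) (B.mem a) (suBasis_norm_le_one B a) U

/-- **The same at coupling `β`**: every smooth Lüscher series of `β S_W` has `|∂^a_e S̃^{(k)}(ιU)| ≤ |β|^{k+1} C_k`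
(the series of `β S` is `β^{k+1} S̃^{(k)}`, `IsLuscherSeries.smul`, plus uniqueness of gradients).
[cite: Luscher2010Trivializing, §4.4 eq. (4.17), §4.5(b)] -/
theorem seriesGradientBound_smul (d n k : ℕ) : ∃ C : ℝ, 0 ≤ C ∧ ∀ (β : ℝ) (L : ℕ) [NeZero L] (B : SuBasis n)
    (Sk : ℕ → AmbConfig d L n → ℝ) (c : ℕ → ℝ), (∀ j, ContDiff ℝ ∞ (Sk j)) →
      IsLuscherSeries B (fun W => β * ambWilsonAction W) Sk c →
      ∀ (U : GaugeConfig d L (Matrix.specialUnitaryGroup (Fin n) ℂ)) (e : Edge d L) (a : B.ι),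
        |linkDeriv e (B.T a) (Sk k) (WilsonFlow.coeConfig U)| ≤ |β| ^ (k + 1) * C := by
  obtain ⟨C, hC0, hC⟩ := wilsonSk_gradBound d n k
  refine ⟨C, hC0, fun β L _ B Sk c hsm hser U e a => ?_⟩
  rw [(IsLuscherSeries.linkDeriv_eq hser ((isLuscherSeries_wilsonSk (d := d) (L := L) B).smul β) hsm
    (fun j => contDiff_const.mul (contDiff_wilsonSk B j)) k).2 e a U]
  rw [linkDeriv_const_mul', abs_mul, abs_pow]
  exact mul_le_mul_of_nonneg_left (hC L B e (B.T a) (B.mem a) (suBasis_norm_le_one B a) U)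
    (pow_nonneg (abs_nonneg β) _)

/-- **`LuscherGeometricGradientBound` without the rate, PROVED**: one sequence `C : ℕ → ℝ` of non-negative
constants, independent of `L`, `B` and the solution, bounds `|∂^a_e S̃^{(k)}(ιU)|` by `C k` for every smooth
Lüscher series of the Wilson action — the statement of `Truncation.lean` §6 with `C ρ^{-k}` replaced by `C k`.
No claim on the growth of `C`. [cite: Luscher2010Trivializing, §4.5(b)] -/
theorem luscherUniformGradientBound (d n : ℕ) : ∃ C : ℕ → ℝ, (∀ k, 0 ≤ C k) ∧ ∀ (L : ℕ) [NeZero L]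
    (B : SuBasis n) (Sk : ℕ → AmbConfig d L n → ℝ) (c : ℕ → ℝ), (∀ k, ContDiff ℝ ∞ (Sk k)) →
      IsLuscherSeries B ambWilsonAction Sk c →
      ∀ (k : ℕ) (U : GaugeConfig d L (Matrix.specialUnitaryGroup (Fin n) ℂ)) (e : Edge d L) (a : B.ι),
        |linkDeriv e (B.T a) (Sk k) (WilsonFlow.coeConfig U)| ≤ C k := by
  choose C hC0 hC using seriesGradientBound d n
  exact ⟨C, hC0, fun L _ B Sk c hsm hser k U e a => hC k L B Sk c hsm hser U e a⟩

/-- The conjectured geometric rate implies the proved uniform bound (sanity link between `Truncation.lean` §6 and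
this file: the conjecture is a STRENGTHENING of a theorem, not an unrelated statement). [folklore] -/
theorem luscherUniform_of_geometric (h : LuscherGeometricGradientBound d n) : ∃ C : ℕ → ℝ, ∀ (L : ℕ) [NeZero L]
    (B : SuBasis n) (Sk : ℕ → AmbConfig d L n → ℝ) (c : ℕ → ℝ), (∀ k, ContDiff ℝ ∞ (Sk k)) →
      IsLuscherSeries B ambWilsonAction Sk c →
      ∀ (k : ℕ) (U : GaugeConfig d L (Matrix.specialUnitaryGroup (Fin n) ℂ)) (e : Edge d L) (a : B.ι),
        |linkDeriv e (B.T a) (Sk k) (WilsonFlow.coeConfig U)| ≤ C k := by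
  obtain ⟨ρ, _, C, hC⟩ := h
  exact ⟨fun k => C * ρ⁻¹ ^ k, fun L _ B Sk c hsm hser k U e a => hC L B Sk c hsm hser k U e a⟩

end Main

end

end Summit.Ventures.LatticeQCDFlow.TrivializingMaps
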